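import Literature.MathematicalPhysics.QuantumFieldTheory.Balaban1983to89.B8Eq1117KLevel

/-!
# `Balaban1983to89.B8SectEKLevelFamily` — [Balaban1985RegularSpaces] Sect. E pp. 95–97 AT `k` LEVELS FOR AN ABSTRACT REMAINDER FAMILY:
# the fixed-point equation (1.117) «C′(λ − H′X) = X» ∕ the transformation (1.118) on `X : 𝔅_k → 𝔤`, its unique solvability «by the
# contraction mapping theorem», «|D′(λ)| = |C′(λ − H′D′(λ))|» (p. 97), the Lipschitz sentence of p. 97 and (1.114), with the LEVEL-`j`
# remainder `C′_j` an ABSTRACT family `Cfam j` carrying print's two tower-local hypotheses (1.121) (self-map bound) and (1.125) (Lipschitz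
# sentence) as DISPLAYED binders — the form in which a consumer may read the top level `j = k` with a restriction functional other than
# (1.29) (cell `ym3-torus`, route `UnitScaleTilt`, stub `stub_halvingStep`, pillar P1♭ brick J4b of `T2FLAT-PLAN-v1.1-addendum-w5g4.md`:
# «Prop. 5 at the top level with (o) in place of (1.29)_k»), and in which dag-n05-b's concrete witness-form file
# `B8SectEKLevelInLambda` (remainder `Cnl L U₀ u₁ j` of [3] (213)) is the instance `Cfam j := Cnl L U₀ u₁ j`, its two hypotheses being
# `B8SectEInLambdaWitness.norm_Cnl_le_tower_of_witness` ∕ `lipschitz_Cnl_tower_of_witness`.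

statement-level skeleton of published theorems with citation tags; proofs where landed; nothing here is a claim about the Yang–Mills mass gap

T. Bałaban, *Spaces of regular gauge field configurations on a lattice and gauge fixing conditions*, Commun. Math. Phys. **99** (1985)
75–102 `[Balaban1985RegularSpaces]` ("B8"; printed page = PDF page + 74), pp. 95–97 [PDF 21–23].  PDF held:
`paper:balaban1985-cmp99-regular-spaces-gauge-fixing` (text layer `p0021.txt`–`p0023.txt` read).  STATUS: published, refereed.

## THE PRINTED TEXT (pp. 95–97)

«We want to construct a function D′(λ) for α₃, α₄ sufficiently small, whose values are configurations X : 𝔅_k → 𝔤, such that the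
transformation λ′ = λ − H′D′(λ) (1.113) changes the function Q′(λ′) into the linear function Q′λ: Q′(λ − H′D′(λ)) = Q′λ. (1.114) …
The function D′(λ) is a solution of the equation C′(λ − H′X) = X, (1.117) or a fixed point of the transformation X → C′(λ − H′X). (1.118)
… Let us assume that |λ| < ½α₄, |Dλ| < ½α₄(Lʲη)⁻¹ on Ω_j, |X| < α₄∕(2B′₀). (1.119)  This implies |λ − H′X| < α₄, |D(λ − H′X)| < α₄(Lʲη)⁻¹
on Ω_j, (1.120) and by the inequality (214) we have |C′(λ − H′X)| < C′₂(α₃ + α₄)α₄, (1.121) … The transformation (1.118) maps the set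
(1.119) of X's into itself if C′₂(α₃ + α₄)α₄ ≦ α₄∕(2B′₀) … |C′(λ − H′X₁) − C′(λ − H′X₂)| ≦ C′₂2B′₀(α₃ + α₄)|X₁ − X₂|, hence the mapping
(1.118) is contractive if e.g. α₃ + α₄ ≦ 1∕(4C′₂B′₀). … Thus by the contraction mapping theorem there exists exactly one solution of
Eq. (1.117). … We take D′(λ) equal to this solution. From Eq. (1.116) we can get much better bounds on it: |D′(λ)| = |C′(λ − H′D′(λ))| <
C′₂(α₃ + α₄)α₄.»

## WHAT IS CERTIFIED HERE (kernel; theorems only; no `sorry`, no `def`, no `instance`, no `notation`)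

Setting (dag-n05-b's `B8Eq1117KLevel` ∕ `B8SectEKLevelInLambda` verbatim, MINUS everything specific to [3]'s remainder): `ℤᵈ` carriers
`Site d`; `𝔸` a complete normed `ℂ`-algebra; a background `U₀` (read only through the parallel transporters `cj (U₀ x κ)` of the covariant
difference); `k` levels, constraint sites `Λ : ℕ → Set (Site d)` (`𝔅_k = {(j, y) : j ≤ k, y ∈ Λ_j}`); `X` in the complete sup-normed space
`B8Eq1117Concrete.XSpace d k 𝔸`; the letter `H′ : XSpace →ₗ[ℂ] (Site d → 𝔸)` with the sup bound `hH0` and the tower-local (1.92)-type modulus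
`hH1`; `λ` in the half-size set (1.119) on every tower `[tlo L y j, thi L y j] = Bʲ(y)`; the REMAINDER FAMILY `Cfam : ℕ → (Site d → 𝔸) →
Site d → 𝔸` with two DISPLAYED rows, at every `(j, y ∈ Λ_j)` and for every `μ` (resp. `μ₁, μ₂`) in the (1.120)-set of the tower of `y`:
(1.121) `‖Cfam j μ y‖ ≤ Cb` and (1.125) `‖Cfam j μ₁ y − Cfam j μ₂ y‖ ≤ Cl·m` for a tower modulus `m` of `μ₁ − μ₂` (sup `≤ m`, covariant
gradient `≤ m·L^{−j}`), together with print's two smallness conditions in product form: «C′₂(α₃ + α₄)α₄ ≦ α₄∕(2B′₀)» as `Cb ≤ α₄∕(2B′₀)` and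
«contractive» as `Cl·B′₀ ≤ ½`.
* §1 `eq1117_existsUnique_kLevel_fam` — «exactly one solution of Eq. (1.117)» in the closed ball `‖X‖ ≤ α₄∕(2B′₀)`, reading
  `X(j, y) = Cfam j (λ − H′X) y` on `𝔅_k` and `X = 0` off `𝔅_k`; `eq1117_solution_mem_of_invariant_fam` — the solution lies in every closed
  set `S ∋ 0` invariant under the masked (1.118) on the ball (r05's reality device `B8SectDSource.fixedPoint_mem_of_invariant`).
* §2 `norm_Dprime_le_kLevel_fam` — «|D′(λ)| = |C′(λ − H′D′(λ))|»: any solution in the ball has `‖X‖ ≤ Cb`; `eq1114_of_fixedPoint_kLevel_fam` —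
  (1.114) from (1.115)–(1.117) for ANY decomposition `Qfull j μ y = Qlin j μ y + Cfam j μ y` with `Qlin j` additive and `Qlin j (H′Y) y = Y(j, y)`
  on `𝔅_k` (pure algebra); `exists_Dprime_kLevel_fam` — «We take D′(λ) equal to this solution».
* (sibling `B8SectEKLevelFamilyLipschitz`: the Lipschitz sentence `‖D′(λ₁) − D′(λ₂)‖ ≤ 2·Cl·m`.)

## HONEST SCOPE

A re-abstraction of dag-n05-b's kernel-checked witness-form file with `Cnl L U₀ u₁ j ↦ Cfam j` and the [3]-specific windows∕witnesses
replaced by the two printed hypotheses they served to prove; proofs are that file's, line for line.  Nothing here discharges (1.121)∕(1.125)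
for any concrete remainder (for [3]'s `Cnl`: `B8SectEInLambdaWitness`; for the cell's top-normalisation remainder: the `ym3-torus` tower file),
nothing here is [B8] Prop. 5 or Theorem 4, nothing continuum ∕ ℝ⁴ ∕ OS ∕ mass-gap ∕ Clay.  Cell `ym3-torus` seat `ym-ust-19936-w8` (g0∕s2),
2026-08-28, `--supports stmt-QuantumFields-19200 --as helper` (★★OWNER ym3-torus-plan g26 ACK 45 (b)).
-/

noncomputable section

open NormedSpace

namespace Literature.MathematicalPhysics.QuantumFieldTheory.Balaban1983to89.B8SectEKLevelFamily

open B7Prop1Explicit B7Prop1Local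
open B7Eq170Flat (cj cj_apply)
open B8Ineq130 (tlo thi)
open B8Eq1122Concrete (cjDiff_sub)
open B8Eq1117Concrete (XSpace)
open B8Eq1117KLevel (dom120_of_119_tower)
open B8SectDSource (fixedPoint_closedBall fixedPoint_mem_of_invariant)

-- `Site` alone could resolve to the torus sites of `Setup.lean`; re-export the `ℤ^d` sites of `B7Prop1Explicit`.
export B7Prop1Explicit (Site)

variable {d : ℕ}

/-! ## §1 «exactly one solution of Eq. (1.117)» at `k` levels, for an abstract remainder family -/

section FixedPoint

variable {𝔸 : Type*} [NormedRing 𝔸] [NormedAlgebra ℂ 𝔸]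
variable {L : ℕ} {U₀ : Site d → Fin d → 𝔸ˣ} {k : ℕ} {Λ : ℕ → Set (Site d)} {H' : XSpace d k 𝔸 →ₗ[ℂ] (Site d → 𝔸)}
  {lam : Site d → 𝔸} {α₄ B₀' Cb Cl : ℝ} {Cfam : ℕ → (Site d → 𝔸) → Site d → 𝔸}

/-- The masked transformation (1.118) `X ↦ 𝟙_{𝔅_k}·C′(λ − H′X)` IS A ½-CONTRACTION OF THE BALL `‖X‖ ≤ α₄∕(2B′₀)` INTO ITSELF (pp. 96–97:
(1.121) self-map + (1.125) contraction) for an abstract remainder family `Cfam` carrying (1.121)∕(1.125) as hypotheses on the (1.120)-set of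
every tower: there is a map `T` on `XSpace` which on the ball is pointwise the masked (1.118), maps the ball into itself, and is ½-Lipschitz there.
[cite: Balaban1985RegularSpaces, (1.118)–(1.121) p.96, (1.125) p.97] -/
private theorem contraction_core_fam (hα₄ : 0 < α₄) (hB : 0 < B₀') (hCb : 0 ≤ Cb)
    (h119b : ∀ j, j ≤ k → ∀ y ∈ Λ j, ∀ x : Site d, InBox (tlo L y j) (thi L y j) x → ‖lam x‖ < α₄ / 2)
    (h119a : ∀ j, j ≤ k → ∀ y ∈ Λ j, ∀ (x : Site d) (κ : Fin d), InBox (tlo L y j) (thi L y j) x →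
      InBox (tlo L y j) (thi L y j) (x + e κ) → ‖cj (U₀ x κ) (lam (x + e κ)) - lam x‖ < α₄ / 2 * ((L : ℝ) ^ j)⁻¹)
    (hH0 : ∀ (X : XSpace d k 𝔸) (x : Site d), ‖H' X x‖ ≤ B₀' * ‖X‖)
    (hH1 : ∀ j, j ≤ k → ∀ y ∈ Λ j, ∀ (X : XSpace d k 𝔸) (x : Site d) (κ : Fin d), InBox (tlo L y j) (thi L y j) x →
      InBox (tlo L y j) (thi L y j) (x + e κ) → ‖cj (U₀ x κ) (H' X (x + e κ)) - H' X x‖ ≤ B₀' * ‖X‖ * ((L : ℝ) ^ j)⁻¹)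
    (hC121 : ∀ j, j ≤ k → ∀ y ∈ Λ j, ∀ μ : Site d → 𝔸,
      (∀ x : Site d, InBox (tlo L y j) (thi L y j) x → ‖μ x‖ < α₄) →
      (∀ (x : Site d) (κ : Fin d), InBox (tlo L y j) (thi L y j) x → InBox (tlo L y j) (thi L y j) (x + e κ) →
        ‖cj (U₀ x κ) (μ (x + e κ)) - μ x‖ < α₄ * ((L : ℝ) ^ j)⁻¹) →
      ‖Cfam j μ y‖ ≤ Cb)
    (hC125 : ∀ j, j ≤ k → ∀ y ∈ Λ j, ∀ (μ₁ μ₂ : Site d → 𝔸) (m : ℝ), 0 ≤ m →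
      (∀ x : Site d, InBox (tlo L y j) (thi L y j) x → ‖μ₁ x‖ < α₄) →
      (∀ (x : Site d) (κ : Fin d), InBox (tlo L y j) (thi L y j) x → InBox (tlo L y j) (thi L y j) (x + e κ) →
        ‖cj (U₀ x κ) (μ₁ (x + e κ)) - μ₁ x‖ < α₄ * ((L : ℝ) ^ j)⁻¹) →
      (∀ x : Site d, InBox (tlo L y j) (thi L y j) x → ‖μ₂ x‖ < α₄) →
      (∀ (x : Site d) (κ : Fin d), InBox (tlo L y j) (thi L y j) x → InBox (tlo L y j) (thi L y j) (x + e κ) →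
        ‖cj (U₀ x κ) (μ₂ (x + e κ)) - μ₂ x‖ < α₄ * ((L : ℝ) ^ j)⁻¹) →
      (∀ x : Site d, InBox (tlo L y j) (thi L y j) x → ‖(μ₁ - μ₂) x‖ ≤ m) →
      (∀ (x : Site d) (κ : Fin d), InBox (tlo L y j) (thi L y j) x → InBox (tlo L y j) (thi L y j) (x + e κ) →
        ‖cj (U₀ x κ) ((μ₁ - μ₂) (x + e κ)) - (μ₁ - μ₂) x‖ ≤ m * ((L : ℝ) ^ j)⁻¹) →
      ‖Cfam j μ₁ y - Cfam j μ₂ y‖ ≤ Cl * m)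
    (hCbρ : Cb ≤ α₄ / (2 * B₀')) (hClB : Cl * B₀' ≤ 1 / 2) :
    ∃ T : XSpace d k 𝔸 → XSpace d k 𝔸,
      (∀ X : XSpace d k 𝔸, ‖X‖ ≤ α₄ / (2 * B₀') → ∀ p : Fin (k + 1) × Site d,
        (p.2 ∈ Λ p.1 → T X p = Cfam p.1 (lam - H' X) p.2) ∧ (p.2 ∉ Λ p.1 → T X p = 0)) ∧
      (∀ X : XSpace d k 𝔸, ‖X‖ ≤ α₄ / (2 * B₀') → ‖T X‖ ≤ α₄ / (2 * B₀')) ∧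
      (∀ X Y : XSpace d k 𝔸, ‖X‖ ≤ α₄ / (2 * B₀') → ‖Y‖ ≤ α₄ / (2 * B₀') → ‖T X - T Y‖ ≤ 1 / 2 * ‖X - Y‖) := by
  classical
  have hρ : 0 ≤ α₄ / (2 * B₀') := by positivity
  -- the masked family of (1.118)
  let F : XSpace d k 𝔸 → (Fin (k + 1) × Site d → 𝔸) := fun X p =>
    if p.2 ∈ Λ p.1 then Cfam p.1 (lam - H' X) p.2 else 0
  -- (1.120) on every tower, for `X` in the ball
  have hdom : ∀ X : XSpace d k 𝔸, ‖X‖ ≤ α₄ / (2 * B₀') → ∀ j, j ≤ k → ∀ y ∈ Λ j,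
      (∀ (x : Site d) (κ : Fin d), InBox (tlo L y j) (thi L y j) x → InBox (tlo L y j) (thi L y j) (x + e κ) →
          ‖cj (U₀ x κ) ((lam - H' X) (x + e κ)) - (lam - H' X) x‖ < α₄ * ((L : ℝ) ^ j)⁻¹) ∧
        ∀ x : Site d, InBox (tlo L y j) (thi L y j) x → ‖(lam - H' X) x‖ < α₄ := fun X hX j hj y hy =>
    dom120_of_119_tower H' hB (by positivity) hH0 (hH1 j hj y hy) (h119a j hj y hy) (h119b j hj y hy) hX
  -- (1.121) at every point of `𝔅_k`, for `X` in the ball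
  have h121 : ∀ X : XSpace d k 𝔸, ‖X‖ ≤ α₄ / (2 * B₀') → ∀ j, j ≤ k → ∀ y ∈ Λ j,
      ‖Cfam j (lam - H' X) y‖ ≤ Cb := fun X hX j hj y hy =>
    hC121 j hj y hy (lam - H' X) (hdom X hX j hj y hy).2 (hdom X hX j hj y hy).1
  have hFbound : ∀ X : XSpace d k 𝔸, ‖X‖ ≤ α₄ / (2 * B₀') → ∀ p : Fin (k + 1) × Site d, ‖F X p‖ ≤ Cb := by
    intro X hX p
    simp only [F]
    split_ifs with hp
    · exact h121 X hX p.1 (Nat.le_of_lt_succ p.1.isLt) p.2 hp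
    · rw [norm_zero]; exact hCb
  -- the transformation (1.118) on the `X`-space (packaged where bounded, `0` otherwise — never used there)
  let T : XSpace d k 𝔸 → XSpace d k 𝔸 := fun X =>
    if h : ∃ C : ℝ, ∀ p, ‖F X p‖ ≤ C then BoundedContinuousFunction.ofNormedAddCommGroupDiscrete (F X) h.choose h.choose_spec
    else 0
  have hT_apply : ∀ X : XSpace d k 𝔸, ‖X‖ ≤ α₄ / (2 * B₀') → ∀ p, T X p = F X p := by
    intro X hX p
    have h : ∃ C : ℝ, ∀ p, ‖F X p‖ ≤ C := ⟨_, hFbound X hX⟩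
    simp only [T, dif_pos h]
    rfl
  refine ⟨T, fun X hX p => ?_, fun X hX => ?_, fun X Y hX hY => ?_⟩
  · -- pointwise description on the ball
    rw [hT_apply X hX p]
    simp only [F]
    constructor
    · intro hp; rw [if_pos hp]
    · intro hp; rw [if_neg hp]
  · -- self-map
    refine (BoundedContinuousFunction.norm_le hρ).2 fun p => ?_
    rw [hT_apply X hX p]
    exact (hFbound X hX p).trans hCbρ
  · -- contraction with constant `½`
    refine (BoundedContinuousFunction.norm_le (by positivity)).2 fun p => ?_
    rw [BoundedContinuousFunction.coe_sub, Pi.sub_apply, hT_apply X hX p, hT_apply Y hY p]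
    simp only [F]
    split_ifs with hp
    · have hj := Nat.le_of_lt_succ p.1.isLt
      obtain ⟨hXa, hXb⟩ := hdom X hX p.1 hj p.2 hp
      obtain ⟨hYa, hYb⟩ := hdom Y hY p.1 hj p.2 hp
      have hdiff : lam - H' X - (lam - H' Y) = H' (Y - X) := by rw [map_sub]; abel
      have hma : ∀ (x : Site d) (κ : Fin d), InBox (tlo L p.2 p.1) (thi L p.2 p.1) x →
          InBox (tlo L p.2 p.1) (thi L p.2 p.1) (x + e κ) →
          ‖cj (U₀ x κ) ((lam - H' X - (lam - H' Y)) (x + e κ)) - (lam - H' X - (lam - H' Y)) x‖ ≤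
            B₀' * ‖X - Y‖ * ((L : ℝ) ^ (p.1 : ℕ))⁻¹ := fun x κ hx hxe => by
        rw [hdiff, norm_sub_rev X Y]; exact hH1 p.1 hj p.2 hp (Y - X) x κ hx hxe
      have hmb : ∀ x : Site d, InBox (tlo L p.2 p.1) (thi L p.2 p.1) x → ‖(lam - H' X - (lam - H' Y)) x‖ ≤ B₀' * ‖X - Y‖ :=
        fun x _ => by rw [hdiff, norm_sub_rev X Y]; exact hH0 (Y - X) x
      have hlip := hC125 p.1 hj p.2 hp (lam - H' X) (lam - H' Y) (B₀' * ‖X - Y‖) (by positivity) hXb hXa hYb hYa hmb hma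
      have hκ : Cl * (B₀' * ‖X - Y‖) ≤ 1 / 2 * ‖X - Y‖ := by
        have hXY := norm_nonneg (X - Y)
        calc Cl * (B₀' * ‖X - Y‖) = (Cl * B₀') * ‖X - Y‖ := by ring
          _ ≤ 1 / 2 * ‖X - Y‖ := mul_le_mul_of_nonneg_right hClB hXY
      exact hlip.trans hκ
    · rw [sub_self, norm_zero]; positivity

/-- Reading a map that is pointwise the masked (1.118) on the ball: `T X = X` iff `X` solves (1.117) on `𝔅_k` and vanishes off `𝔅_k`.
[cite: Balaban1985RegularSpaces, (1.117)–(1.118) p.96] -/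
private theorem fixed_iff_pointwise_fam {T : XSpace d k 𝔸 → XSpace d k 𝔸} {X : XSpace d k 𝔸}
    (hT : ∀ p : Fin (k + 1) × Site d,
      (p.2 ∈ Λ p.1 → T X p = Cfam p.1 (lam - H' X) p.2) ∧ (p.2 ∉ Λ p.1 → T X p = 0)) :
    T X = X ↔ ∀ (j : ℕ) (hj : j ≤ k) (y : Site d),
      (y ∈ Λ j → X (⟨j, Nat.lt_succ_of_le hj⟩, y) = Cfam j (lam - H' X) y) ∧
        (y ∉ Λ j → X (⟨j, Nat.lt_succ_of_le hj⟩, y) = 0) := by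
  constructor
  · intro hTX j hj y
    have h : T X (⟨j, Nat.lt_succ_of_le hj⟩, y) = X (⟨j, Nat.lt_succ_of_le hj⟩, y) :=
      congrArg (fun Z : XSpace d k 𝔸 => Z (⟨j, Nat.lt_succ_of_le hj⟩, y)) hTX
    obtain ⟨h1, h2⟩ := hT (⟨j, Nat.lt_succ_of_le hj⟩, y)
    constructor
    · intro hy; rw [← h, h1 hy]
    · intro hy; rw [← h, h2 hy]
  · intro hP
    apply BoundedContinuousFunction.ext
    intro p
    obtain ⟨h1, h2⟩ := hP p.1 (Nat.le_of_lt_succ p.1.isLt) p.2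
    have hp : (⟨(p.1 : ℕ), Nat.lt_succ_of_le (Nat.le_of_lt_succ p.1.isLt)⟩ : Fin (k + 1)) = p.1 := Fin.ext rfl
    rw [hp] at h1 h2
    obtain ⟨t1, t2⟩ := hT p
    by_cases hy : p.2 ∈ Λ p.1
    · rw [t1 hy, h1 hy]
    · rw [t2 hy, h2 hy]

/-- **«BY THE CONTRACTION MAPPING THEOREM THERE EXISTS EXACTLY ONE SOLUTION OF Eq. (1.117)» AT `k` LEVELS, FOR AN ABSTRACT REMAINDER
FAMILY** (p. 97): with `λ` in the half-size set (1.119) on every tower, the letter `H′` with sup bound `B′₀` and the (1.92)-type tower modulus,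
and the remainder family `Cfam` obeying (1.121) `‖C′_j(μ)(y)‖ ≤ Cb` and (1.125) `‖C′_j(μ₁)(y) − C′_j(μ₂)(y)‖ ≤ Cl·m` on the (1.120)-set of every
tower, under «C′₂(α₃ + α₄)α₄ ≦ α₄∕(2B′₀)» (`Cb ≤ α₄∕(2B′₀)`) and the contraction condition (`Cl·B′₀ ≤ ½`): there is EXACTLY ONE `X ∈ XSpace d k 𝔸`
with `‖X‖ ≤ α₄∕(2B′₀)` such that `X(j, y) = C′_j(λ − H′X)(y)` for `y ∈ Λ_j` and `X(j, y) = 0` for `y ∉ Λ_j` (`j ≤ k`).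
[cite: Balaban1985RegularSpaces, (1.117)–(1.121) pp.96–97, p.97 (contraction, exactly one solution)] -/
theorem eq1117_existsUnique_kLevel_fam [CompleteSpace 𝔸] (hα₄ : 0 < α₄) (hB : 0 < B₀') (hCb : 0 ≤ Cb)
    (h119b : ∀ j, j ≤ k → ∀ y ∈ Λ j, ∀ x : Site d, InBox (tlo L y j) (thi L y j) x → ‖lam x‖ < α₄ / 2)
    (h119a : ∀ j, j ≤ k → ∀ y ∈ Λ j, ∀ (x : Site d) (κ : Fin d), InBox (tlo L y j) (thi L y j) x →
      InBox (tlo L y j) (thi L y j) (x + e κ) → ‖cj (U₀ x κ) (lam (x + e κ)) - lam x‖ < α₄ / 2 * ((L : ℝ) ^ j)⁻¹)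
    (hH0 : ∀ (X : XSpace d k 𝔸) (x : Site d), ‖H' X x‖ ≤ B₀' * ‖X‖)
    (hH1 : ∀ j, j ≤ k → ∀ y ∈ Λ j, ∀ (X : XSpace d k 𝔸) (x : Site d) (κ : Fin d), InBox (tlo L y j) (thi L y j) x →
      InBox (tlo L y j) (thi L y j) (x + e κ) → ‖cj (U₀ x κ) (H' X (x + e κ)) - H' X x‖ ≤ B₀' * ‖X‖ * ((L : ℝ) ^ j)⁻¹)
    (hC121 : ∀ j, j ≤ k → ∀ y ∈ Λ j, ∀ μ : Site d → 𝔸,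
      (∀ x : Site d, InBox (tlo L y j) (thi L y j) x → ‖μ x‖ < α₄) →
      (∀ (x : Site d) (κ : Fin d), InBox (tlo L y j) (thi L y j) x → InBox (tlo L y j) (thi L y j) (x + e κ) →
        ‖cj (U₀ x κ) (μ (x + e κ)) - μ x‖ < α₄ * ((L : ℝ) ^ j)⁻¹) →
      ‖Cfam j μ y‖ ≤ Cb)
    (hC125 : ∀ j, j ≤ k → ∀ y ∈ Λ j, ∀ (μ₁ μ₂ : Site d → 𝔸) (m : ℝ), 0 ≤ m →
      (∀ x : Site d, InBox (tlo L y j) (thi L y j) x → ‖μ₁ x‖ < α₄) →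
      (∀ (x : Site d) (κ : Fin d), InBox (tlo L y j) (thi L y j) x → InBox (tlo L y j) (thi L y j) (x + e κ) →
        ‖cj (U₀ x κ) (μ₁ (x + e κ)) - μ₁ x‖ < α₄ * ((L : ℝ) ^ j)⁻¹) →
      (∀ x : Site d, InBox (tlo L y j) (thi L y j) x → ‖μ₂ x‖ < α₄) →
      (∀ (x : Site d) (κ : Fin d), InBox (tlo L y j) (thi L y j) x → InBox (tlo L y j) (thi L y j) (x + e κ) →
        ‖cj (U₀ x κ) (μ₂ (x + e κ)) - μ₂ x‖ < α₄ * ((L : ℝ) ^ j)⁻¹) →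
      (∀ x : Site d, InBox (tlo L y j) (thi L y j) x → ‖(μ₁ - μ₂) x‖ ≤ m) →
      (∀ (x : Site d) (κ : Fin d), InBox (tlo L y j) (thi L y j) x → InBox (tlo L y j) (thi L y j) (x + e κ) →
        ‖cj (U₀ x κ) ((μ₁ - μ₂) (x + e κ)) - (μ₁ - μ₂) x‖ ≤ m * ((L : ℝ) ^ j)⁻¹) →
      ‖Cfam j μ₁ y - Cfam j μ₂ y‖ ≤ Cl * m)
    (hCbρ : Cb ≤ α₄ / (2 * B₀')) (hClB : Cl * B₀' ≤ 1 / 2) :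
    ∃! X : XSpace d k 𝔸, ‖X‖ ≤ α₄ / (2 * B₀') ∧
      ∀ (j : ℕ) (hj : j ≤ k) (y : Site d),
        (y ∈ Λ j → X (⟨j, Nat.lt_succ_of_le hj⟩, y) = Cfam j (lam - H' X) y) ∧
          (y ∉ Λ j → X (⟨j, Nat.lt_succ_of_le hj⟩, y) = 0) := by
  obtain ⟨T, hT, hmaps, hlip⟩ := contraction_core_fam hα₄ hB hCb h119b h119a hH0 hH1 hC121 hC125 hCbρ hClB
  have hρ : 0 ≤ α₄ / (2 * B₀') := by positivity
  obtain ⟨X, ⟨hXρ, hXfix⟩, huniq⟩ := fixedPoint_closedBall T hρ (κ := 1 / 2) (by norm_num) (by norm_num) hmaps hlip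
  refine ⟨X, ⟨hXρ, (fixed_iff_pointwise_fam (hT X hXρ)).1 hXfix⟩, fun Y hY =>
    huniq Y ⟨hY.1, (fixed_iff_pointwise_fam (hT Y hY.1)).2 hY.2⟩⟩

/-- **THE SOLUTION OF (1.117) LIES IN EVERY CLOSED SET `S ∋ 0` INVARIANT UNDER THE MASKED (1.118) ON THE BALL**, abstract remainder family
(r05's device for the reality of fixed points, `B8SectDSource.fixedPoint_mem_of_invariant`, p. 93 «λ … with values in the complexified
algebra»; here for `X`, e.g. `S` = the skew-adjoint configurations): if `S ⊂ XSpace d k 𝔸` is closed, contains `0`, and for every `X ∈ S` in the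
ball every configuration `Y` that is `C′_j(λ − H′X)` on `𝔅_k` and `0` off `𝔅_k` again lies in `S`, then any `X` in the ball solving (1.117) on
`𝔅_k` and vanishing off `𝔅_k` lies in `S`.
[cite: Balaban1985RegularSpaces, (1.117)–(1.118) p.96, p.97, p.93 (real solutions)] -/
theorem eq1117_solution_mem_of_invariant_fam [CompleteSpace 𝔸] (hα₄ : 0 < α₄) (hB : 0 < B₀') (hCb : 0 ≤ Cb)
    (h119b : ∀ j, j ≤ k → ∀ y ∈ Λ j, ∀ x : Site d, InBox (tlo L y j) (thi L y j) x → ‖lam x‖ < α₄ / 2)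
    (h119a : ∀ j, j ≤ k → ∀ y ∈ Λ j, ∀ (x : Site d) (κ : Fin d), InBox (tlo L y j) (thi L y j) x →
      InBox (tlo L y j) (thi L y j) (x + e κ) → ‖cj (U₀ x κ) (lam (x + e κ)) - lam x‖ < α₄ / 2 * ((L : ℝ) ^ j)⁻¹)
    (hH0 : ∀ (X : XSpace d k 𝔸) (x : Site d), ‖H' X x‖ ≤ B₀' * ‖X‖)
    (hH1 : ∀ j, j ≤ k → ∀ y ∈ Λ j, ∀ (X : XSpace d k 𝔸) (x : Site d) (κ : Fin d), InBox (tlo L y j) (thi L y j) x →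
      InBox (tlo L y j) (thi L y j) (x + e κ) → ‖cj (U₀ x κ) (H' X (x + e κ)) - H' X x‖ ≤ B₀' * ‖X‖ * ((L : ℝ) ^ j)⁻¹)
    (hC121 : ∀ j, j ≤ k → ∀ y ∈ Λ j, ∀ μ : Site d → 𝔸,
      (∀ x : Site d, InBox (tlo L y j) (thi L y j) x → ‖μ x‖ < α₄) →
      (∀ (x : Site d) (κ : Fin d), InBox (tlo L y j) (thi L y j) x → InBox (tlo L y j) (thi L y j) (x + e κ) →
        ‖cj (U₀ x κ) (μ (x + e κ)) - μ x‖ < α₄ * ((L : ℝ) ^ j)⁻¹) →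
      ‖Cfam j μ y‖ ≤ Cb)
    (hC125 : ∀ j, j ≤ k → ∀ y ∈ Λ j, ∀ (μ₁ μ₂ : Site d → 𝔸) (m : ℝ), 0 ≤ m →
      (∀ x : Site d, InBox (tlo L y j) (thi L y j) x → ‖μ₁ x‖ < α₄) →
      (∀ (x : Site d) (κ : Fin d), InBox (tlo L y j) (thi L y j) x → InBox (tlo L y j) (thi L y j) (x + e κ) →
        ‖cj (U₀ x κ) (μ₁ (x + e κ)) - μ₁ x‖ < α₄ * ((L : ℝ) ^ j)⁻¹) →
      (∀ x : Site d, InBox (tlo L y j) (thi L y j) x → ‖μ₂ x‖ < α₄) →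
      (∀ (x : Site d) (κ : Fin d), InBox (tlo L y j) (thi L y j) x → InBox (tlo L y j) (thi L y j) (x + e κ) →
        ‖cj (U₀ x κ) (μ₂ (x + e κ)) - μ₂ x‖ < α₄ * ((L : ℝ) ^ j)⁻¹) →
      (∀ x : Site d, InBox (tlo L y j) (thi L y j) x → ‖(μ₁ - μ₂) x‖ ≤ m) →
      (∀ (x : Site d) (κ : Fin d), InBox (tlo L y j) (thi L y j) x → InBox (tlo L y j) (thi L y j) (x + e κ) →
        ‖cj (U₀ x κ) ((μ₁ - μ₂) (x + e κ)) - (μ₁ - μ₂) x‖ ≤ m * ((L : ℝ) ^ j)⁻¹) →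
      ‖Cfam j μ₁ y - Cfam j μ₂ y‖ ≤ Cl * m)
    (hCbρ : Cb ≤ α₄ / (2 * B₀')) (hClB : Cl * B₀' ≤ 1 / 2)
    (S : Set (XSpace d k 𝔸)) (hS : IsClosed S) (h0 : (0 : XSpace d k 𝔸) ∈ S)
    (hinv : ∀ X ∈ S, ‖X‖ ≤ α₄ / (2 * B₀') → ∀ Y : XSpace d k 𝔸,
      (∀ p : Fin (k + 1) × Site d, (p.2 ∈ Λ p.1 → Y p = Cfam p.1 (lam - H' X) p.2) ∧ (p.2 ∉ Λ p.1 → Y p = 0)) →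
      Y ∈ S)
    {X : XSpace d k 𝔸} (hXρ : ‖X‖ ≤ α₄ / (2 * B₀'))
    (hzero : ∀ (j : ℕ) (hj : j ≤ k) (y : Site d), y ∉ Λ j → X (⟨j, Nat.lt_succ_of_le hj⟩, y) = 0)
    (hfix : ∀ (j : ℕ) (hj : j ≤ k) (y : Site d), y ∈ Λ j → Cfam j (lam - H' X) y = X (⟨j, Nat.lt_succ_of_le hj⟩, y)) :
    X ∈ S := by
  obtain ⟨T, hT, hmaps, hlip⟩ := contraction_core_fam hα₄ hB hCb h119b h119a hH0 hH1 hC121 hC125 hCbρ hClB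
  have hρ : 0 ≤ α₄ / (2 * B₀') := by positivity
  have hTX : T X = X :=
    (fixed_iff_pointwise_fam (hT X hXρ)).2 fun j hj y => ⟨fun hy => (hfix j hj y hy).symm, fun hy => hzero j hj y hy⟩
  exact fixedPoint_mem_of_invariant T hρ (κ := 1 / 2) (by norm_num) (by norm_num) hmaps hlip S hS h0
    (fun Y hY hYρ => hinv Y hY hYρ (T Y) (hT Y hYρ)) hXρ hTX

end FixedPoint

/-! ## §2 `D′(λ)`, its size, and (1.114) on `𝔅_k`, for an abstract remainder family -/

section Dprime

variable {𝔸 : Type*} [NormedRing 𝔸] [NormedAlgebra ℂ 𝔸]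
variable {L : ℕ} {U₀ : Site d → Fin d → 𝔸ˣ} {k : ℕ} {Λ : ℕ → Set (Site d)} {H' : XSpace d k 𝔸 →ₗ[ℂ] (Site d → 𝔸)}
  {lam : Site d → 𝔸} {α₄ B₀' Cb Cl : ℝ} {Cfam : ℕ → (Site d → 𝔸) → Site d → 𝔸}

/-- **«|D′(λ)| = |C′(λ − H′D′(λ))| < C′₂(α₃ + α₄)α₄»** (p. 97) AT `k` LEVELS, abstract remainder family: any `X` in the ball solving (1.117) on
`𝔅_k` and vanishing off `𝔅_k` has `‖X‖ ≤ Cb`, the (1.121) constant of the family.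
[cite: Balaban1985RegularSpaces, p.97, (1.116) p.96, (1.121) p.96] -/
theorem norm_Dprime_le_kLevel_fam (hB : 0 < B₀') (hCb : 0 ≤ Cb)
    (h119b : ∀ j, j ≤ k → ∀ y ∈ Λ j, ∀ x : Site d, InBox (tlo L y j) (thi L y j) x → ‖lam x‖ < α₄ / 2)
    (h119a : ∀ j, j ≤ k → ∀ y ∈ Λ j, ∀ (x : Site d) (κ : Fin d), InBox (tlo L y j) (thi L y j) x →
      InBox (tlo L y j) (thi L y j) (x + e κ) → ‖cj (U₀ x κ) (lam (x + e κ)) - lam x‖ < α₄ / 2 * ((L : ℝ) ^ j)⁻¹)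
    (hH0 : ∀ (X : XSpace d k 𝔸) (x : Site d), ‖H' X x‖ ≤ B₀' * ‖X‖)
    (hH1 : ∀ j, j ≤ k → ∀ y ∈ Λ j, ∀ (X : XSpace d k 𝔸) (x : Site d) (κ : Fin d), InBox (tlo L y j) (thi L y j) x →
      InBox (tlo L y j) (thi L y j) (x + e κ) → ‖cj (U₀ x κ) (H' X (x + e κ)) - H' X x‖ ≤ B₀' * ‖X‖ * ((L : ℝ) ^ j)⁻¹)
    (hC121 : ∀ j, j ≤ k → ∀ y ∈ Λ j, ∀ μ : Site d → 𝔸,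
      (∀ x : Site d, InBox (tlo L y j) (thi L y j) x → ‖μ x‖ < α₄) →
      (∀ (x : Site d) (κ : Fin d), InBox (tlo L y j) (thi L y j) x → InBox (tlo L y j) (thi L y j) (x + e κ) →
        ‖cj (U₀ x κ) (μ (x + e κ)) - μ x‖ < α₄ * ((L : ℝ) ^ j)⁻¹) →
      ‖Cfam j μ y‖ ≤ Cb)
    {X : XSpace d k 𝔸} (hXρ : ‖X‖ ≤ α₄ / (2 * B₀'))
    (hzero : ∀ (j : ℕ) (hj : j ≤ k) (y : Site d), y ∉ Λ j → X (⟨j, Nat.lt_succ_of_le hj⟩, y) = 0)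
    (hfix : ∀ (j : ℕ) (hj : j ≤ k) (y : Site d), y ∈ Λ j → Cfam j (lam - H' X) y = X (⟨j, Nat.lt_succ_of_le hj⟩, y)) :
    ‖X‖ ≤ Cb := by
  refine (BoundedContinuousFunction.norm_le hCb).2 fun p => ?_
  have hp : ((⟨(p.1 : ℕ), Nat.lt_succ_of_le (Nat.le_of_lt_succ p.1.isLt)⟩ : Fin (k + 1)), p.2) = p :=
    Prod.ext (Fin.ext rfl) rfl
  by_cases hy : p.2 ∈ Λ p.1
  · obtain ⟨ha, hb⟩ := dom120_of_119_tower H' hB (by positivity) hH0 (hH1 p.1 (Nat.le_of_lt_succ p.1.isLt) p.2 hy)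
      (h119a p.1 (Nat.le_of_lt_succ p.1.isLt) p.2 hy) (h119b p.1 (Nat.le_of_lt_succ p.1.isLt) p.2 hy) hXρ
    have h := hfix p.1 (Nat.le_of_lt_succ p.1.isLt) p.2 hy
    rw [hp] at h
    rw [← h]
    exact hC121 p.1 (Nat.le_of_lt_succ p.1.isLt) p.2 hy (lam - H' X) hb ha
  · have h := hzero p.1 (Nat.le_of_lt_succ p.1.isLt) p.2 hy
    rw [hp] at h
    rw [h, norm_zero]
    exact hCb

/-- **(1.114) FROM (1.115)–(1.117) ON `𝔅_k`, FOR ANY DECOMPOSITION OF A RESTRICTION FUNCTIONAL INTO «LINEAR AVERAGING + REMAINDER»** (print's use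
of (213) of [3], p. 96: «Using the equality (213) [3] the above equation can be written in the following form …»): if `Qfull j μ y = Qlin j μ y +
C′_j(μ)(y)` on `𝔅_k` with `Qlin j` additive in `μ` and `Qlin j (H′Y) y = Y(j, y)` on `𝔅_k` («Q′H′ = I», (1.91)), then any solution `X` of
(1.117) on `𝔅_k` gives `Qfull j (λ − H′X) y = Qlin j λ y` on `𝔅_k` — pure additive algebra.
[cite: Balaban1985RegularSpaces, (1.114)–(1.117) pp.95–96, (1.91) p.91] -/
theorem eq1114_of_fixedPoint_kLevel_fam (Qfull Qlin : ℕ → (Site d → 𝔸) → Site d → 𝔸)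
    (h213 : ∀ (j : ℕ), j ≤ k → ∀ y ∈ Λ j, ∀ μ : Site d → 𝔸, Qfull j μ y = Qlin j μ y + Cfam j μ y)
    (hlin : ∀ (j : ℕ) (μ₁ μ₂ : Site d → 𝔸) (y : Site d), Qlin j (μ₁ - μ₂) y = Qlin j μ₁ y - Qlin j μ₂ y)
    (hQH : ∀ (Y : XSpace d k 𝔸) (j : ℕ) (hj : j ≤ k) (y : Site d), y ∈ Λ j → Qlin j (H' Y) y = Y (⟨j, Nat.lt_succ_of_le hj⟩, y))
    {X : XSpace d k 𝔸}
    (hfix : ∀ (j : ℕ) (hj : j ≤ k) (y : Site d), y ∈ Λ j → Cfam j (lam - H' X) y = X (⟨j, Nat.lt_succ_of_le hj⟩, y)) :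
    ∀ (j : ℕ), j ≤ k → ∀ y ∈ Λ j, Qfull j (lam - H' X) y = Qlin j lam y := by
  intro j hj y hy
  rw [h213 j hj y hy, hlin, hQH X j hj y hy, hfix j hj y hy]
  abel

/-- **«WE TAKE D′(λ) EQUAL TO THIS SOLUTION»** (p. 97) AT `k` LEVELS, abstract remainder family: there is `X = D′(λ)` with `‖X‖ ≤ α₄∕(2B′₀)`,
`‖X‖ ≤ Cb`, vanishing off `𝔅_k` and solving (1.117) on `𝔅_k`.  ((1.114) for any displayed decomposition then follows from
`eq1114_of_fixedPoint_kLevel_fam`.)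
[cite: Balaban1985RegularSpaces, (1.113)–(1.117) pp.95–96, p.97] -/
theorem exists_Dprime_kLevel_fam [CompleteSpace 𝔸] (hα₄ : 0 < α₄) (hB : 0 < B₀') (hCb : 0 ≤ Cb)
    (h119b : ∀ j, j ≤ k → ∀ y ∈ Λ j, ∀ x : Site d, InBox (tlo L y j) (thi L y j) x → ‖lam x‖ < α₄ / 2)
    (h119a : ∀ j, j ≤ k → ∀ y ∈ Λ j, ∀ (x : Site d) (κ : Fin d), InBox (tlo L y j) (thi L y j) x →
      InBox (tlo L y j) (thi L y j) (x + e κ) → ‖cj (U₀ x κ) (lam (x + e κ)) - lam x‖ < α₄ / 2 * ((L : ℝ) ^ j)⁻¹)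
    (hH0 : ∀ (X : XSpace d k 𝔸) (x : Site d), ‖H' X x‖ ≤ B₀' * ‖X‖)
    (hH1 : ∀ j, j ≤ k → ∀ y ∈ Λ j, ∀ (X : XSpace d k 𝔸) (x : Site d) (κ : Fin d), InBox (tlo L y j) (thi L y j) x →
      InBox (tlo L y j) (thi L y j) (x + e κ) → ‖cj (U₀ x κ) (H' X (x + e κ)) - H' X x‖ ≤ B₀' * ‖X‖ * ((L : ℝ) ^ j)⁻¹)
    (hC121 : ∀ j, j ≤ k → ∀ y ∈ Λ j, ∀ μ : Site d → 𝔸,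
      (∀ x : Site d, InBox (tlo L y j) (thi L y j) x → ‖μ x‖ < α₄) →
      (∀ (x : Site d) (κ : Fin d), InBox (tlo L y j) (thi L y j) x → InBox (tlo L y j) (thi L y j) (x + e κ) →
        ‖cj (U₀ x κ) (μ (x + e κ)) - μ x‖ < α₄ * ((L : ℝ) ^ j)⁻¹) →
      ‖Cfam j μ y‖ ≤ Cb)
    (hC125 : ∀ j, j ≤ k → ∀ y ∈ Λ j, ∀ (μ₁ μ₂ : Site d → 𝔸) (m : ℝ), 0 ≤ m →
      (∀ x : Site d, InBox (tlo L y j) (thi L y j) x → ‖μ₁ x‖ < α₄) →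
      (∀ (x : Site d) (κ : Fin d), InBox (tlo L y j) (thi L y j) x → InBox (tlo L y j) (thi L y j) (x + e κ) →
        ‖cj (U₀ x κ) (μ₁ (x + e κ)) - μ₁ x‖ < α₄ * ((L : ℝ) ^ j)⁻¹) →
      (∀ x : Site d, InBox (tlo L y j) (thi L y j) x → ‖μ₂ x‖ < α₄) →
      (∀ (x : Site d) (κ : Fin d), InBox (tlo L y j) (thi L y j) x → InBox (tlo L y j) (thi L y j) (x + e κ) →
        ‖cj (U₀ x κ) (μ₂ (x + e κ)) - μ₂ x‖ < α₄ * ((L : ℝ) ^ j)⁻¹) →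
      (∀ x : Site d, InBox (tlo L y j) (thi L y j) x → ‖(μ₁ - μ₂) x‖ ≤ m) →
      (∀ (x : Site d) (κ : Fin d), InBox (tlo L y j) (thi L y j) x → InBox (tlo L y j) (thi L y j) (x + e κ) →
        ‖cj (U₀ x κ) ((μ₁ - μ₂) (x + e κ)) - (μ₁ - μ₂) x‖ ≤ m * ((L : ℝ) ^ j)⁻¹) →
      ‖Cfam j μ₁ y - Cfam j μ₂ y‖ ≤ Cl * m)
    (hCbρ : Cb ≤ α₄ / (2 * B₀')) (hClB : Cl * B₀' ≤ 1 / 2) :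
    ∃ X : XSpace d k 𝔸, ‖X‖ ≤ α₄ / (2 * B₀') ∧ ‖X‖ ≤ Cb ∧
      (∀ (j : ℕ) (hj : j ≤ k) (y : Site d), y ∉ Λ j → X (⟨j, Nat.lt_succ_of_le hj⟩, y) = 0) ∧
      ∀ (j : ℕ) (hj : j ≤ k) (y : Site d), y ∈ Λ j → Cfam j (lam - H' X) y = X (⟨j, Nat.lt_succ_of_le hj⟩, y) := by
  obtain ⟨X, ⟨hXρ, hXfix⟩, -⟩ := eq1117_existsUnique_kLevel_fam hα₄ hB hCb h119b h119a hH0 hH1 hC121 hC125 hCbρ hClB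
  have hfix : ∀ (j : ℕ) (hj : j ≤ k) (y : Site d), y ∈ Λ j → Cfam j (lam - H' X) y = X (⟨j, Nat.lt_succ_of_le hj⟩, y) :=
    fun j hj y hy => ((hXfix j hj y).1 hy).symm
  have hzero : ∀ (j : ℕ) (hj : j ≤ k) (y : Site d), y ∉ Λ j → X (⟨j, Nat.lt_succ_of_le hj⟩, y) = 0 :=
    fun j hj y hy => (hXfix j hj y).2 hy
  exact ⟨X, hXρ, norm_Dprime_le_kLevel_fam hB hCb h119b h119a hH0 hH1 hC121 hXρ hzero hfix, hzero, hfix⟩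

end Dprime

end Literature.MathematicalPhysics.QuantumFieldTheory.Balaban1983to89.B8SectEKLevelFamily

end
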